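import Summits.Ventures.PercRepro.C025ProfileGirthSuccSuccDual
import Summits.Ventures.PercRepro.C025ProfileGirthPred
import Summits.Ventures.PercRepro.C025ProfileGirthTable

/-!
# THE ROW `(q, q+2)` AT GIRTH `≥ q+1` — THE DUAL INEQUALITY IS A THEOREM, HENCE THE ROW (night-3 g20)

**THEOREM (`dual_count`).** Let `M` be a finite matroid in which every set of at most `q` points is independent, `A ⊆ E`
with `m` points and `p ≤ ρ(A)`, `q + 2 ≤ p`.  Then `C(p, 2) · C(m − 2, q) ≤ C(q+2, 2) · #{independent (q+2)-subsets of A}`.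
PROOF by induction on `q`, and for fixed `q` on `m`.  `q = 0`: the pairs of an independent `p`-subset.  `q + 1`: if `A` is
independent, `C(m,2) · C(m−2, q+1) = C(q+3, 2) · C(m, q+3)`.  Otherwise take a basis `Z` of `A` and `x ∈ A ∖ Z`; the
independent `(q+3)`-subsets of `A` are those of `A ∖ x` (`f₁`) plus the sets `U ∪ {x}` with `U` an independent `(q+2)`-set
of the contraction `M ／ {x}` inside `A ∖ x` (`f₂`).  The inner induction at `(M, A ∖ x, p)` (`Z ⊆ A ∖ x` keeps the rank)
gives `C(p,2) · C(m−3, q+1) ≤ C(q+3,2) · f₁`; the outer induction at `(M ／ {x}, A ∖ x, p − 1)` (a basis through `x`,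
minus `x`; every `q`-set of `M ／ {x}` is independent since every `(q+1)`-set of `M` is) gives
`C(p−1, 2) · C(m−3, q) ≤ C(q+2, 2) · f₂`, and `(q+3) · C(p−1, 2) ≥ (q+1) · C(p, 2)` exactly when `p ≥ q + 3`; Pascal's rule
`C(m−2, q+1) = C(m−3, q+1) + C(m−3, q)` closes.
**COROLLARIES.** `dual_of_girth` — (DUAL_B) for every `q`-subset; **`profileIneq_succ_succ_of_girth (hq : 1 ≤ q) (hg) (hrank :
q + 3 ≤ ρ(E)) : Profile.ProfileIneq M q (q + 2)`** — THE ROW `(q, q+2)` OF (Π) (C-032) AT GIRTH `≥ q + 1`, and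
`profileIneq_succ_succ_of_girth_all` at every rank; **`rls_succ_succ_succ_of_girth (hq : 2 ≤ q) (hg) : ThmN.RLS M (q+3) q`** —
C-025 AT `(q+3, q)` ON EVERY FINITE MATROID OF GIRTH `≥ q + 1`; `rls_of_girth_pred_all (p q) (hq : 2 ≤ q) (hpq : q + 3 ≤ p)
(every set of ≤ p−3 points independent) : ThmN.RLS M p q` — C-025 at every `(p, q)`, `p ≥ q + 3`, at girth `≥ p − 2`.
No `def`, no `instance`, no notation.  Axioms: standard.
-/

open scoped Matroid

namespace PercRepro

open Set Finset ThmH Staged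

namespace GirthRows

variable {α : Type} [DecidableEq α]

open scoped Classical in
/-- The independent `(k+1)`-subsets of `A` split by whether they contain `x ∈ A`: those inside `A ∖ x`, and the sets
`U ∪ {x}` with `U` a `k`-subset of `A ∖ x`. -/
theorem card_filter_indep_powersetCard_split (M : Matroid α) (A : Finset α) {x : α} (hx : x ∈ A) (k : ℕ) :
    ((A.powersetCard (k + 1)).filter (fun U : Finset α => M.Indep (U : Set α))).card =
      (((A.erase x).powersetCard (k + 1)).filter (fun U : Finset α => M.Indep (U : Set α))).card +
        (((A.erase x).powersetCard k).filter (fun U : Finset α => M.Indep ((insert x U : Finset α) : Set α))).card := by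
  have hxA' : x ∉ A.erase x := Finset.notMem_erase x A
  have hA : A = insert x (A.erase x) := (Finset.insert_erase hx).symm
  conv_lhs => rw [hA]
  rw [Finset.powersetCard_succ_insert hxA', Finset.filter_union, Finset.card_union_of_disjoint, Finset.filter_image,
    Finset.card_image_of_injOn]
  · intro U hU U' hU' heq
    rw [Finset.mem_coe, Finset.mem_filter, Finset.mem_powersetCard] at hU hU'
    have h1 : x ∉ U := fun h => hxA' (hU.1.1 h)
    have h2 : x ∉ U' := fun h => hxA' (hU'.1.1 h)
    rw [← Finset.erase_insert h1, ← Finset.erase_insert h2, heq]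
  · rw [Finset.disjoint_left]
    intro U hU hU'
    rw [Finset.mem_filter, Finset.mem_powersetCard] at hU
    rw [Finset.mem_filter, Finset.mem_image] at hU'
    obtain ⟨V, _, hVU⟩ := hU'.1
    have : x ∈ U := hVU ▸ Finset.mem_insert_self x V
    exact hxA' (hU.1.1 this)

open scoped Classical in
/-- **THE DUAL INEQUALITY** (`dual_count`): for every finite matroid in which every set of at most `q` points is
independent, every `A ⊆ E` and every `p ≤ ρ(A)` with `q + 2 ≤ p`:
`C(p, 2) · C(#A − 2, q) ≤ C(q+2, 2) · #{independent (q+2)-subsets of A}`. -/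
theorem dual_count (q : ℕ) : ∀ (M : Matroid α) [M.Finite] (A : Finset α), A ⊆ gr M →
    (∀ T ⊆ M.E, T.encard ≤ q → M.Indep T) → ∀ p : ℕ, ((p : ℕ) : ℕ∞) ≤ M.eRk (A : Set α) → q + 2 ≤ p →
    p.choose 2 * (A.card - 2).choose q ≤
      (q + 2).choose 2 * ((A.powersetCard (q + 2)).filter (fun U : Finset α => M.Indep (U : Set α))).card := by
  induction q with
  | zero =>
    intro M _ A hAg _ p hp hqp
    -- an independent `p`-subset of `A` and its pairs
    have hAE : (A : Set α) ⊆ M.E := by rw [← coe_gr]; exact_mod_cast hAg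
    obtain ⟨Z, hZ⟩ := M.exists_isBasis (A : Set α) hAE
    have hpZ : ((p : ℕ) : ℕ∞) ≤ Z.encard := by rw [hZ.encard_eq_eRk]; exact hp
    obtain ⟨Z₀, hZ₀Z, hZ₀c⟩ := Set.exists_subset_encard_eq hpZ
    have hfin : Z₀.Finite := Set.finite_of_encard_eq_coe hZ₀c
    have hZ₀i : M.Indep Z₀ := hZ.indep.subset hZ₀Z
    have hZ₀A : hfin.toFinset ⊆ A := by
      rw [Set.Finite.toFinset_subset]
      exact hZ₀Z.trans hZ.subset
    have hcard : hfin.toFinset.card = p := by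
      have := hZ₀c
      rw [Set.Finite.encard_eq_coe_toFinset_card hfin] at this
      exact_mod_cast this
    have hsub : hfin.toFinset.powersetCard 2 ⊆ (A.powersetCard 2).filter (fun U : Finset α => M.Indep (U : Set α)) := by
      intro U hU
      rw [Finset.mem_powersetCard] at hU
      rw [Finset.mem_filter, Finset.mem_powersetCard]
      refine ⟨⟨hU.1.trans hZ₀A, hU.2⟩, ?_⟩
      apply hZ₀i.subset
      rw [← Set.Finite.coe_toFinset hfin]
      exact_mod_cast hU.1
    have := Finset.card_le_card hsub
    rw [Finset.card_powersetCard, hcard] at this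
    simpa using this
  | succ q ihq =>
    intro M _ A
    -- inner induction on `#A`
    suffices h : ∀ k, ∀ (M : Matroid α) [M.Finite] (A : Finset α), A.card = k → A ⊆ gr M →
        (∀ T ⊆ M.E, T.encard ≤ (q + 1 : ℕ) → M.Indep T) → ∀ p : ℕ, ((p : ℕ) : ℕ∞) ≤ M.eRk (A : Set α) →
        q + 1 + 2 ≤ p →
        p.choose 2 * (A.card - 2).choose (q + 1) ≤
          (q + 1 + 2).choose 2 * ((A.powersetCard (q + 1 + 2)).filter (fun U : Finset α => M.Indep (U : Set α))).card from
      h A.card M A rfl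
    intro k
    induction k using Nat.strong_induction_on with
    | _ k ihk =>
    intro M _ A hk hAg hg p hp hqp
    have hAE : (A : Set α) ⊆ M.E := by rw [← coe_gr]; exact_mod_cast hAg
    by_cases hAi : M.Indep (A : Set α)
    · -- `A` independent: equality with `p ≤ #A`
      have hall : (A.powersetCard (q + 1 + 2)).filter (fun U : Finset α => M.Indep (U : Set α)) = A.powersetCard (q + 1 + 2) := by
        apply Finset.filter_true_of_mem
        intro U hU
        exact hAi.subset (Finset.coe_subset.2 (Finset.mem_powersetCard.1 hU).1)
      rw [hall, Finset.card_powersetCard]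
      have hpA : p ≤ A.card := by
        have h1 : ((p : ℕ) : ℕ∞) ≤ ((A.card : ℕ) : ℕ∞) := by
          refine hp.trans ?_
          rw [← Set.encard_coe_eq_coe_finsetCard]
          exact M.eRk_le_encard _
        exact_mod_cast h1
      have hid := Nat.choose_mul (n := A.card) (k := q + 1 + 2) (s := 2) (by omega)
      have h3 : q + 1 + 2 - 2 = q + 1 := by omega
      rw [h3] at hid
      calc p.choose 2 * (A.card - 2).choose (q + 1) ≤ A.card.choose 2 * (A.card - 2).choose (q + 1) :=
            Nat.mul_le_mul_right _ (Nat.choose_le_choose 2 hpA)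
        _ = A.card.choose (q + 1 + 2) * (q + 1 + 2).choose 2 := hid.symm
        _ = (q + 1 + 2).choose 2 * A.card.choose (q + 1 + 2) := mul_comm _ _
    · -- `A` dependent: a basis `Z` of `A` and a point `x ∈ A ∖ Z`
      obtain ⟨Z, hZ⟩ := M.exists_isBasis (A : Set α) hAE
      have hZne : Z ≠ (A : Set α) := fun h => hAi (h ▸ hZ.indep)
      obtain ⟨x, hxA, hxZ⟩ : ∃ x ∈ A, x ∉ Z := by
        by_contra hcon
        push Not at hcon
        apply hZne
        apply Set.Subset.antisymm hZ.subset
        intro z hz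
        exact hcon z (Finset.mem_coe.1 hz)
      set A' := A.erase x with hA'
      have hA'g : A' ⊆ gr M := (Finset.erase_subset _ _).trans hAg
      have hA'c : A'.card = k - 1 := by rw [hA', Finset.card_erase_of_mem hxA, hk]
      have hk1 : 1 ≤ k := by rw [← hk]; exact Finset.card_pos.2 ⟨x, hxA⟩
      have hxE : x ∈ M.E := hAE (Finset.mem_coe.2 hxA)
      -- `{x}` is independent (every `1`-set is)
      have hxi : M.Indep ({x} : Set α) := by
        apply hg _ (Set.singleton_subset_iff.2 hxE)
        rw [Set.encard_singleton]
        exact_mod_cast (by omega : 1 ≤ q + 1)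
      -- (1) the inner induction at `(M, A', p)`: `Z ⊆ A'` keeps the rank
      have hZA' : Z ⊆ (A' : Set α) := by
        intro z hz
        rw [hA', Finset.coe_erase]
        exact ⟨hZ.subset hz, fun h => hxZ (h ▸ hz)⟩
      have hp' : ((p : ℕ) : ℕ∞) ≤ M.eRk (A' : Set α) := by
        refine hp.trans ?_
        rw [← hZ.encard_eq_eRk]
        exact hZ.indep.encard_le_eRk_of_subset hZA'
      have h1 := ihk (k - 1) (by omega) M A' hA'c hA'g hg p hp' hqp
      -- (2) the outer induction at `(M ／ {x}, A', p − 1)`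
      haveI : (M ／ ({x} : Set α)).Finite := Matroid.contract_finite
      have hgrC : A' ⊆ gr (M ／ ({x} : Set α)) := by
        rw [← Finset.coe_subset, coe_gr, Matroid.contract_ground, hA', Finset.coe_erase]
        exact Set.sdiff_subset_sdiff_left hAE
      have hgC : ∀ T ⊆ (M ／ ({x} : Set α)).E, T.encard ≤ (q : ℕ) → (M ／ ({x} : Set α)).Indep T := by
        intro T hT hTc
        rw [Matroid.contract_ground] at hT
        rw [hxi.contract_indep_iff]
        have hxT : x ∉ T := fun h => (hT h).2 rfl
        refine ⟨Set.disjoint_singleton_right.2 hxT, ?_⟩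
        apply hg
        · exact Set.union_subset (hT.trans Set.sdiff_subset) (Set.singleton_subset_iff.2 hxE)
        · rw [Set.union_singleton, Set.encard_insert_of_notMem hxT]
          calc T.encard + 1 ≤ (q : ℕ∞) + 1 := add_le_add hTc (le_refl 1)
            _ = ((q + 1 : ℕ) : ℕ∞) := by push_cast; rfl
      -- a basis of `A` through `x`, minus `x`, is independent in the contraction
      obtain ⟨Z₂, hZ₂, hxZ₂⟩ := hxi.subset_isBasis_of_subset (Set.singleton_subset_iff.2 (Finset.mem_coe.2 hxA)) hAE
      have hxZ₂' : x ∈ Z₂ := hxZ₂ rfl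
      have hZ₂i : (M ／ ({x} : Set α)).Indep (Z₂ \ {x}) := by
        rw [hxi.contract_indep_iff]
        refine ⟨Set.disjoint_sdiff_left, ?_⟩
        rw [Set.sdiff_union_of_subset (Set.singleton_subset_iff.2 hxZ₂')]
        exact hZ₂.indep
      have hZ₂A' : Z₂ \ {x} ⊆ (A' : Set α) := by
        rw [hA', Finset.coe_erase]
        exact Set.sdiff_subset_sdiff_left hZ₂.subset
      have hpC : (((p - 1 : ℕ) : ℕ) : ℕ∞) ≤ (M ／ ({x} : Set α)).eRk (A' : Set α) := by
        refine le_trans ?_ (hZ₂i.encard_le_eRk_of_subset hZ₂A')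
        have h1 := Set.encard_sdiff_singleton_add_one hxZ₂'
        rw [hZ₂.encard_eq_eRk] at h1
        have h2 : ((p : ℕ) : ℕ∞) ≤ (Z₂ \ {x}).encard + 1 := by rw [h1]; exact hp
        have h3 : ((p - 1 : ℕ) : ℕ∞) + 1 ≤ (Z₂ \ {x}).encard + 1 := by
          calc ((p - 1 : ℕ) : ℕ∞) + 1 = ((p - 1 + 1 : ℕ) : ℕ∞) := by push_cast; rfl
            _ = ((p : ℕ) : ℕ∞) := by congr 1; omega
            _ ≤ (Z₂ \ {x}).encard + 1 := h2
        exact (ENat.add_le_add_iff_right (by simp)).1 h3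
      have h2 := ihq (M ／ ({x} : Set α)) A' hgrC hgC (p - 1) hpC (by omega)
      -- (3) the split of the independent `(q+3)`-subsets of `A`
      have hsplit := card_filter_indep_powersetCard_split M A hxA (q + 2)
      -- the sets `insert x U` are independent iff `U` is independent in the contraction
      have hiff : ∀ U ∈ A'.powersetCard (q + 2),
          M.Indep ((insert x U : Finset α) : Set α) ↔ (M ／ ({x} : Set α)).Indep (U : Set α) := by
        intro U hU
        rw [Finset.mem_powersetCard] at hU
        have hxU : x ∉ U := fun h => Finset.notMem_erase x A (hU.1 h)
        rw [hxi.contract_indep_iff, Finset.coe_insert, Set.union_singleton]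
        constructor
        · intro h
          exact ⟨Set.disjoint_singleton_right.2 (fun h' => hxU (Finset.mem_coe.1 h')), h⟩
        · intro h
          exact h.2
      have hcount : (((A'.powersetCard (q + 2)).filter
          (fun U : Finset α => M.Indep ((insert x U : Finset α) : Set α))).card =
          ((A'.powersetCard (q + 2)).filter (fun U : Finset α => (M ／ ({x} : Set α)).Indep (U : Set α))).card) := by
        congr 1
        exact Finset.filter_congr hiff
      rw [hcount] at hsplit
      -- (4) the arithmetic
      have hpas : (A.card - 2).choose (q + 1) = (A'.card - 2).choose (q + 1) + (A'.card - 2).choose q := by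
        have hm : A.card - 2 = (A'.card - 2) + 1 := by
          rw [hA'c, hk]
          have : q + 1 + 2 ≤ k := by
            have : ((p : ℕ) : ℕ∞) ≤ ((A.card : ℕ) : ℕ∞) := by
              refine hp.trans ?_
              rw [← Set.encard_coe_eq_coe_finsetCard]
              exact M.eRk_le_encard _
            have : p ≤ A.card := by exact_mod_cast this
            omega
          omega
        rw [hm, Nat.choose_succ_succ', add_comm]
      -- from `h2`: `(q+1) · C(q+3,2) · f₂ ≥ (q+3) · C(p−1,2) · C(#A'−2, q) ≥ (q+1) · C(p,2) · C(#A'−2, q)`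
      have hq3 : (q + 3) * (p - 1).choose 2 ≥ (q + 1) * p.choose 2 := by
        obtain ⟨p', rfl⟩ : ∃ p', p = p' + 1 := ⟨p - 1, by omega⟩
        simp only [Nat.add_sub_cancel]
        have hp' : q + 2 ≤ p' := by omega
        have hQ : ((q : ℚ) + 3) * ((p'.choose 2 : ℕ) : ℚ) ≥ ((q : ℚ) + 1) * (((p' + 1).choose 2 : ℕ) : ℚ) := by
          rw [Nat.cast_choose_two, Nat.cast_choose_two]
          push_cast
          have hp'Q : (q : ℚ) + 2 ≤ p' := by exact_mod_cast hp'
          have hp'0 : (0 : ℚ) ≤ p' := by positivity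
          nlinarith [mul_nonneg hp'0 (sub_nonneg.2 hp'Q)]
        exact_mod_cast hQ
      have hmain : (q + 1 + 2).choose 2 * ((A'.powersetCard (q + 2)).filter
          (fun U : Finset α => (M ／ ({x} : Set α)).Indep (U : Set α))).card ≥ p.choose 2 * (A'.card - 2).choose q := by
        -- multiply `h2` by `q + 3` and use `(q+3) C(q+2,2) = (q+1) C(q+3,2)`
        have hc1 : (q + 3) * (q + 2).choose 2 = (q + 1) * (q + 1 + 2).choose 2 := by
          have := Nat.choose_mul_succ_eq (q + 2) 2
          have h3 : q + 2 + 1 - 2 = q + 1 := by omega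
          rw [h3] at this
          rw [mul_comm, this, mul_comm]
        have h2' : (q + 3) * ((q + 2).choose 2 * ((A'.powersetCard (q + 2)).filter
            (fun U : Finset α => (M ／ ({x} : Set α)).Indep (U : Set α))).card) ≥
            (q + 3) * ((p - 1).choose 2 * (A'.card - 2).choose q) := Nat.mul_le_mul_left _ h2
        have h3 : (q + 1) * ((q + 1 + 2).choose 2 * ((A'.powersetCard (q + 2)).filter
            (fun U : Finset α => (M ／ ({x} : Set α)).Indep (U : Set α))).card) ≥
            (q + 1) * (p.choose 2 * (A'.card - 2).choose q) := by
          calc (q + 1) * ((q + 1 + 2).choose 2 * _) = (q + 3) * ((q + 2).choose 2 * _) := by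
                rw [← mul_assoc, ← hc1, mul_assoc]
            _ ≥ (q + 3) * ((p - 1).choose 2 * (A'.card - 2).choose q) := h2'
            _ = ((q + 3) * (p - 1).choose 2) * (A'.card - 2).choose q := by ring
            _ ≥ ((q + 1) * p.choose 2) * (A'.card - 2).choose q := Nat.mul_le_mul_right _ hq3
            _ = (q + 1) * (p.choose 2 * (A'.card - 2).choose q) := by ring
        exact Nat.le_of_mul_le_mul_left h3 (by omega)
      rw [hpas, Nat.mul_add, hsplit, Nat.mul_add]
      exact Nat.add_le_add h1 hmain

variable {M : Matroid α} [M.Finite]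

open scoped Classical in
/-- **(DUAL_B) for every `q`-subset** at girth `≥ q + 1`: `price(B) · C(n − q − 2, q) ≤ #{independent (q+2)-subsets of
E ∖ B}`. -/
theorem dual_of_girth {q : ℕ} (hg : ∀ T ⊆ M.E, T.encard ≤ q → M.Indep T) :
    ∀ B ∈ (gr M).powersetCard q,
      Profile.price M q (q + 2) B * (((gr M).card - q - 2).choose q : ℚ) ≤
        ((((gr M \ B).powersetCard (q + 2)).filter (fun U : Finset α => M.Indep (U : Set α))).card : ℚ) := by
  intro B hB
  rw [Finset.mem_powersetCard] at hB
  obtain ⟨hBg, hBc⟩ := hB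
  set A := gr M \ B with hA
  have hAg : A ⊆ gr M := Finset.sdiff_subset
  have hsd : A.card = (gr M).card - q := by rw [hA, Finset.card_sdiff_of_subset hBg, hBc]
  unfold Profile.price
  split_ifs with hthr
  · set p := rkN M A with hp
    have hpdef : (M.eRk (A : Set α)).toNat = p := rfl
    rw [hpdef]
    have hpq : q + 2 ≤ p := by
      have h := hthr
      rw [← Staged.coe_rkN] at h
      exact_mod_cast h
    have hple : ((p : ℕ) : ℕ∞) ≤ M.eRk (A : Set α) := by rw [← Staged.coe_rkN]
    have hdc := dual_count q M A hAg hg p hple hpq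
    have hAc : A.card - 2 = (gr M).card - q - 2 := by omega
    rw [hAc] at hdc
    -- `C(p+q, q+2)/C(p+q, q) = C(p,2)/C(q+2,2)`
    have hid := choose_succ_succ_mul_choose_two p q
    have hpos1 : (0 : ℚ) < ((p + q).choose q : ℕ) := by exact_mod_cast Nat.choose_pos (by omega)
    have hpos2 : (0 : ℚ) < ((q + 2).choose 2 : ℕ) := by exact_mod_cast Nat.choose_pos (by omega)
    rw [div_mul_eq_mul_div, div_le_iff₀ hpos1]
    have hdcQ : ((p.choose 2 : ℕ) : ℚ) * (((gr M).card - q - 2).choose q : ℕ) ≤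
        (((q + 2).choose 2 : ℕ) : ℚ) *
          ((((gr M \ B).powersetCard (q + 2)).filter (fun U : Finset α => M.Indep (U : Set α))).card : ℚ) := by
      exact_mod_cast hdc
    have hidQ : (((p + q).choose (q + 2) : ℕ) : ℚ) * ((q + 2).choose 2 : ℕ) =
        (((p + q).choose q : ℕ) : ℚ) * (p.choose 2 : ℕ) := by exact_mod_cast hid
    -- multiply the target by `C(q+2,2) > 0`
    apply le_of_mul_le_mul_right _ hpos2
    calc (((p + q).choose (q + 2) : ℕ) : ℚ) * (((gr M).card - q - 2).choose q : ℕ) * ((q + 2).choose 2 : ℕ)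
        = (((p + q).choose q : ℕ) : ℚ) * ((p.choose 2 : ℕ) * (((gr M).card - q - 2).choose q : ℕ)) := by
          rw [mul_right_comm, hidQ]; ring
      _ ≤ (((p + q).choose q : ℕ) : ℚ) * (((q + 2).choose 2 : ℕ) *
          ((((gr M \ B).powersetCard (q + 2)).filter (fun U : Finset α => M.Indep (U : Set α))).card : ℚ)) :=
          mul_le_mul_of_nonneg_left hdcQ hpos1.le
      _ = _ := by ring
  · rw [zero_mul]
    exact Nat.cast_nonneg _

/-- **THE ROW `(q, q+2)` OF (Π) AT GIRTH `≥ q + 1`** (C-032): on every finite matroid in which every set of at most `q`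
points is independent, with `q ≥ 1` and rank `≥ q + 3`, `Σ_{B : ρ(B) = q} price(B) ≤ #{S : ρ(S) = q + 2}`. -/
theorem profileIneq_succ_succ_of_girth {q : ℕ} (hq : 1 ≤ q) (hg : ∀ T ⊆ M.E, T.encard ≤ q → M.Indep T)
    (hrank : ((q + 3 : ℕ) : ℕ∞) ≤ M.eRank) : Profile.ProfileIneq M q (q + 2) :=
  profileIneq_succ_succ_of_dual hq hg hrank (dual_of_girth hg)

/-- The row `(q, q+2)` at girth `≥ q + 1` at EVERY rank (rank `< q + 2`: every price is `0`; rank `q + 2`: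
complementation). -/
theorem profileIneq_succ_succ_of_girth_all {q : ℕ} (hq : 1 ≤ q) (hg : ∀ T ⊆ M.E, T.encard ≤ q → M.Indep T) :
    Profile.ProfileIneq M q (q + 2) := by
  rcases lt_trichotomy M.eRank ((q + 2 : ℕ) : ℕ∞) with h | h | h
  · exact profileIneq_of_eRank_lt h
  · exact profileIneq_of_eRank_eq h
  · apply profileIneq_succ_succ_of_girth hq hg
    have : ((q + 3 : ℕ) : ℕ∞) = ((q + 2 : ℕ) : ℕ∞) + 1 := by push_cast; rfl
    rw [this]
    exact (ENat.add_one_le_iff (by simp)).2 h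

/-- **C-025 AT `(q+3, q)` ON EVERY FINITE MATROID OF GIRTH `≥ q + 1`** (`q ≥ 2`): the rows `(q, q+1)` (g18) and `(q, q+2)`. -/
theorem rls_succ_succ_succ_of_girth {q : ℕ} (hq : 2 ≤ q) (hg : ∀ T ⊆ M.E, T.encard ≤ q → M.Indep T) :
    ThmN.RLS M (q + 3) q := by
  apply rls_of_profileIneq_rows
  intro u hqu hup
  rcases (show u = q + 1 ∨ u = q + 2 by omega) with rfl | rfl
  · exact profileIneq_succ_of_girth hq hg
  · exact profileIneq_succ_succ_of_girth_all (by omega) hg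

/-- **C-025 AT EVERY `(p, q)`, `p ≥ q + 3`, `q ≥ 2`, ON EVERY FINITE MATROID OF GIRTH `≥ p − 2`** (every set of at most
`p − 3` points independent): `p = q + 3` is `rls_succ_succ_succ_of_girth`, `p ≥ q + 4` is g19's `rls_of_girth_pred`. -/
theorem rls_of_girth_pred_all (p q : ℕ) (hq : 2 ≤ q) (hpq : q + 3 ≤ p)
    (hg : ∀ T ⊆ M.E, T.encard + 3 ≤ p → M.Indep T) : ThmN.RLS M p q := by
  rcases Nat.lt_or_ge p (q + 4) with h | h
  · have hp : p = q + 3 := by omega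
    subst hp
    apply rls_succ_succ_succ_of_girth hq
    intro T hT hTc
    apply hg T hT
    calc T.encard + 3 ≤ (q : ℕ∞) + 3 := add_le_add hTc (le_refl 3)
      _ = ((q + 3 : ℕ) : ℕ∞) := by push_cast; rfl
  · exact rls_of_girth_pred p q hq h hg

end GirthRows

end PercRepro
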